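import Summits.Ventures.CertifiedManyBodySolver.Observables.PairLROTowerWitnessGroundStateSpinDensity
import Summits.Ventures.CertifiedManyBodySolver.Observables.RungLeavesPairLROTTPrime
import Literature.MathematicalPhysics.QuantumLattice.TwoChemicalPotentialGroundStatesAreGaugeInvariant
import HarnessLib

/-!
# A CHARGE GAP EXCLUDES PAIR LONG-RANGE ORDER: `0 < Δ_c(n) ⇒ ObsPairLROCeilingAt t′ U n 0`
# (and the ground-state-complete one-point reading with the rows of EVERY supporting chemical potential)

HONEST FRAMING: structure / soundness theorems for the CEILING side of the cuprate question (D-0082 (c), rung CQ);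
a ceiling never speaks to the presence of pairing; not a superconductivity verdict; no number of record. Crew
hubbard-obs (D-0042), seat `hubbard-obs-gs-2` g4 (ground-state row theory). Zero compute; no definition; no named
fact; no `sorry`.

The tree's Koma–Tasaki tower witnesses (`PairLROTowerWitnessGroundState{,AllMu,SpinDensity}.lean`, seat gs-2 g3)
turn pair LRO `c₀ > 0` of a family of sector ground states of `hubbardTorusTT' L t t' U` at density `n` into a
translation-invariant state `ω` with `Re ω(Φ₀^g) ≥ (k/(k+1))√c₀` which is a Bratteli–Robinson ground state of
`H^{tt'} − μN` for EVERY `μ ∈ [μ₋(n), μ₊(n)]` (the subdifferential of the convex energy density at `n`). The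
Literature theorem `TwoChemicalPotentialGroundStatesAreGaugeInvariant` (this seat, g4) says that a
translation-invariant ground state at TWO chemical potentials is gauge invariant, so `ω(Φ₀^g) = 0`. Hence:

* `liminf_pairFieldLRO_le_sq_of_groundState_allMu_onePoint_bound` — THE READING WITH ALL SUPPORTING `μ`: a bound
  `Re ω(Φ₀^g) ≤ M` on the class {translation invariant, `ω(n_{0σ}) = n/2`, minimiser AND ground state of
  `H^{tt'} − μN` for every `μ ∈ [μ₋(n), μ₊(n)]`} gives `liminf_k u_k ≤ M²` (the `_spinDensity` reading of g3 used
  ONE `μc`; here the class is cut by the ground-state rows of every supporting `μ` simultaneously — the same proof).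
* `liminf_pairFieldLRO_le_zero_of_chemPot_lt` — **a kink of `e(n)` kills pair LRO**: if `μ₋(n) < μ₊(n)` then every
  family of unit `(rectN n L, S^z = 0)`-sector ground states has `liminf_k u_k ≤ 0`, for every form factor `g`.
* `chemPotMinusTT'_eq_chemPotPlusTT'_of_pairLRO` / `chargeGapTT'_eq_zero_of_pairLRO` — contrapositive DICTIONARY:
  a density carrying pair LRO (`0 < liminf_k u_k` for some family) has `μ₋(n) = μ₊(n)` (`Δ_c(n) = 0`): the energy
  density is differentiable there («a superconducting density is compressibility-regular»).
* registry form: `ObsPairLROCeilingAt_of_chargeGap_pos` (`0 < chargeGapTT' 1 tp U n ⇒ ObsPairLROCeilingAt tp U n c'`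
  for every `c' ≥ 0`, in particular `c' = 0`) and `M3ObsPairLROCeilingAt_of_chargeGap_pos` at `(8, 7/8, t′)`.

WHAT THIS IS NOT: no density of the Hubbard model is shown to have a charge gap here; a kink of `e(n)` is NOT
certifiable from energy windows of positive width (the gap cards' «`chargeGapTT'_nonneg` is the whole lower side»),
so today this is a LOGICAL route to ABSENT (incompressible ⇒ no pair LRO), not a certified number.

References: T. Koma, H. Tasaki, J. Stat. Phys. 76 (1994) 745–803, Theorem 5 [KomaTasaki1994]; O. Bratteli,
A. Kishimoto, D. W. Robinson, Commun. Math. Phys. 64 (1978) 41–48, Thm. 2 [BratteliKishimotoRobinson1978];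
O. Bratteli, D. W. Robinson, *OAQSM 2* (1997) Prop. 5.3.19, §5.2.2 [BratteliRobinsonII1997]; E. H. Lieb,
R. Seiringer, J. P. Solovej, J. Yngvason, *The Mathematics of the Bose Gas and its Condensation* (2005) §11.3
eq. (11.29)–(11.30) (BEC ⇒ no cusp, hard-core bosons) [LSSY2005]; E. H. Lieb, F. Y. Wu, Physica A 321 (2003) 1,
§7 (`μ±`, charge gap) [LiebWuPhysicaA2003].
-/

noncomputable section

namespace Summit.Ventures.CertifiedManyBodySolver.Observables

open Matrix Complex Finset Literature.MathematicalPhysics.QuantumLattice Literature.Probability.LatticeModels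
open Literature.MathematicalPhysics.QuantumLattice.HubbardWave0 ThermodynamicLimit Filter Topology
open scoped ComplexOrder ComplexConjugate BigOperators

section Family

variable (g : Site 2 → ℝ)

/-- **The ground-state-complete one-point reading with the rows of EVERY supporting chemical potential.**
`U ≥ 0`, `0 < n < 2`. If `Re ω(Φ₀^g) ≤ M` for every translation-invariant state `ω` with `ω(n_{0↑}) = ω(n_{0↓}) = n/2`
that is a mean-energy minimiser AND a Bratteli–Robinson ground state of `hubbardTTPrimeMuInteraction t t' U μ` for
EVERY `μ ∈ [μ₋(n), μ₊(n)]`, then every family of unit `(rectN n L, S^z = 0)`-sector ground states of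
`hubbardTorusTT' L t t' U` has `liminf_k u_k ≤ M²`. [cite: KomaTasaki1994, Theorem 5]
[cite: BratteliKishimotoRobinson1978, Thm. 2 (p. 47)] -/
theorem liminf_pairFieldLRO_le_sq_of_groundState_allMu_onePoint_bound (t t' : ℝ) {U n : ℝ}
    (hU : 0 ≤ U) (hn0 : 0 < n) (hn2 : n < 2) {M : ℝ}
    (hM : ∀ ω : InfVolFermionState 2, ω.IsTranslationInvariant →
      (∀ σ : Fin 2, ω.expect {0} (nAt 0 (Finset.mem_singleton_self 0) σ) = (((n / 2 : ℝ)) : ℂ)) →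
      (∀ μ ∈ Set.Icc (chemPotMinusTT' t t' U n) (chemPotPlusTT' t t' U n),
        ω.IsMeanEnergyMinimiser (hubbardTTPrimeMuInteraction t t' U μ) 1 ∧
        ω.IsGroundState (hubbardTTPrimeMuInteraction t t' U μ) 1) →
        (ω.expect (pairRegion (insert (0 : Site 2) unitSteps) 0)
          (localPairAt (insert (0 : Site 2) unitSteps) g 0)).re ≤ M)
    (ψ : ∀ L, Fock (Orb (FermionTorus 2 L)))
    (hψ : ∀ L, IsGroundStateInSector (hubbardTorusTT' L t t' U) (rectN n L) 0 (ψ L))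
    (hψ1 : ∀ L, star (ψ L) ⬝ᵥ ψ L = 1) :
    liminf (fun k : ℕ => (∑ x ∈ halfOpenBox 2 (2 * k), ∑ y ∈ halfOpenBox 2 (2 * k),
        torusPullback (pairFieldCorr g ψ) (2 * k) x y) / ((#(halfOpenBox 2 (2 * k)) : ℝ)) ^ 2) atTop ≤
      M ^ 2 := by
  set useq : ℕ → ℝ := fun k => (∑ x ∈ halfOpenBox 2 (2 * k), ∑ y ∈ halfOpenBox 2 (2 * k),
      torusPullback (pairFieldCorr g ψ) (2 * k) x y) / ((#(halfOpenBox 2 (2 * k)) : ℝ)) ^ 2 with huseq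
  change liminf useq atTop ≤ M ^ 2
  set vseq : ℕ → ℝ := fun m =>
    (expect ((pairField g (m + 1))ᴴ * pairField g (m + 1)) (ψ (m + 1))).re / (((m + 1 : ℕ) : ℝ)) ^ 4
    with hvseq
  have hterm : ∀ k : ℕ, 1 ≤ k → ∃ m : ℕ, 2 * k = m + 1 ∧ useq k = vseq m := by
    intro k hk
    obtain ⟨m, hm⟩ : ∃ m, 2 * k = m + 1 := ⟨2 * k - 1, by omega⟩
    refine ⟨m, hm, ?_⟩
    simp only [huseq, hvseq]
    rw [hm, torusLROSeq_pairFieldCorr_succ]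
  have hvnonneg : ∀ m : ℕ, 0 ≤ vseq m := fun m => by
    simp only [hvseq]
    refine div_nonneg ?_ (by positivity)
    exact (Complex.nonneg_iff.1
      ((Matrix.posSemidef_conjTranspose_mul_self (pairField g (m + 1))).dotProduct_mulVec_nonneg
        (ψ (m + 1)))).1
  have hnonneg : ∀ k : ℕ, 1 ≤ k → 0 ≤ useq k := fun k hk => by
    obtain ⟨m, -, heq⟩ := hterm k hk
    rw [heq]
    exact hvnonneg m
  have hbdd : IsBoundedUnder (· ≥ ·) atTop useq :=
    isBoundedUnder_of_eventually_ge (a := 0) (Filter.eventually_atTop.2 ⟨1, fun k hk => hnonneg k hk⟩)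
  by_contra hcon
  rw [not_le] at hcon
  obtain ⟨c₀, hc₀M, hc₀lim⟩ := exists_between hcon
  have hc₀ : 0 < c₀ := lt_of_le_of_lt (sq_nonneg M) hc₀M
  have hev : ∀ᶠ k : ℕ in atTop, c₀ < useq k := eventually_lt_of_lt_liminf hc₀lim hbdd
  -- the tower height: `(kt/(kt+1))·√c₀ > M`
  have hsqrt_pos : 0 < Real.sqrt c₀ := Real.sqrt_pos.2 hc₀
  have hMlt : M < Real.sqrt c₀ := by
    have h1 : |M| < Real.sqrt c₀ := by
      rw [← Real.sqrt_sq_eq_abs]; exact Real.sqrt_lt_sqrt (sq_nonneg M) hc₀M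
    exact lt_of_le_of_lt (le_abs_self M) h1
  obtain ⟨kt, hkt⟩ : ∃ kt : ℕ, M < (kt : ℝ) / (kt + 1) * Real.sqrt c₀ := by
    set δ : ℝ := 1 - M / Real.sqrt c₀ with hδ
    have hδpos : 0 < δ := by
      rw [hδ, sub_pos, div_lt_one hsqrt_pos]; exact hMlt
    obtain ⟨kt, hkt⟩ := exists_nat_gt (1 / δ)
    refine ⟨kt, ?_⟩
    have hk1 : (0 : ℝ) < kt + 1 := by positivity
    have h1 : 1 / ((kt : ℝ) + 1) < δ := by
      rw [div_lt_iff₀ hk1]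
      have : 1 / δ * δ = 1 := by field_simp
      nlinarith [hkt, hδpos]
    have h2 : (kt : ℝ) / (kt + 1) = 1 - 1 / (kt + 1) := by field_simp; ring
    rw [h2]
    have h3 : M / Real.sqrt c₀ < 1 - 1 / ((kt : ℝ) + 1) := by rw [hδ] at h1; linarith
    have := (div_lt_iff₀ hsqrt_pos).1 h3
    linarith
  -- the LRO floor along the sides `2 (j + 1) = (2 j + 1) + 1`
  set Ls : ℕ → ℕ := fun j => (2 * j + 1) + 1 with hLs
  haveI hLne : ∀ j, NeZero (Ls j) := fun j => ⟨by simp [hLs]⟩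
  have hLs_top : Tendsto Ls atTop atTop := by
    refine tendsto_atTop_mono (fun j => ?_) tendsto_id
    simp only [hLs, id]; omega
  have hlro : ∀ᶠ j in atTop, c₀ * (Ls j : ℝ) ^ 4 ≤
      (expect ((pairField g (Ls j))ᴴ * pairField g (Ls j)) (ψ (Ls j))).re := by
    have hev' : ∀ᶠ j : ℕ in atTop, c₀ < useq (j + 1) := (tendsto_add_atTop_nat 1).eventually hev
    filter_upwards [hev'] with j hj
    obtain ⟨m, hm, heq⟩ := hterm (j + 1) (by omega)
    have hmj : m = 2 * j + 1 := by omega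
    rw [heq] at hj
    simp only [hvseq] at hj
    have h := hj.le
    rw [le_div_iff₀ (by positivity)] at h
    subst hmj
    exact h
  obtain ⟨Ξ, φ, ω, -, -, hTI, hspin, -, -, hall, hamp⟩ :=
    exists_torusLimit_towerWitness_groundState_spinDensity g t t' hU hn0 hn2 ψ hψ hψ1 hLs_top hc₀ hlro kt
  have hle := hM ω hTI hspin hall
  linarith

/-- **A KINK OF THE ENERGY DENSITY KILLS PAIR LONG-RANGE ORDER.** `U ≥ 0`, `0 < n < 2`, any `t, t'`, any form
factor `g`: if `μ₋(n) < μ₊(n)` (two supporting chemical potentials at density `n` — a charge gap) then every family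
of unit `(rectN n L, S^z = 0)`-sector ground states of `hubbardTorusTT' L t t' U` has `liminf_k u_k ≤ 0`: the tower
witness's torus limit is a translation-invariant ground state of `H^{tt'} − μ₋N` and of `H^{tt'} − μ₊N`, hence gauge
invariant (`TwoChemicalPotentialGroundStatesAreGaugeInvariant`), hence has zero pair amplitude.
[cite: KomaTasaki1994, Theorem 5] [cite: BratteliRobinsonII1997, Prop. 5.3.19 and §5.2.2]
[cite: LSSY2005, §11.3 eq. (11.29)–(11.30)] -/
theorem liminf_pairFieldLRO_le_zero_of_chemPot_lt (t t' : ℝ) {U n : ℝ} (hU : 0 ≤ U) (hn0 : 0 < n)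
    (hn2 : n < 2) (hgap : chemPotMinusTT' t t' U n < chemPotPlusTT' t t' U n)
    (ψ : ∀ L, Fock (Orb (FermionTorus 2 L)))
    (hψ : ∀ L, IsGroundStateInSector (hubbardTorusTT' L t t' U) (rectN n L) 0 (ψ L))
    (hψ1 : ∀ L, star (ψ L) ⬝ᵥ ψ L = 1) :
    liminf (fun k : ℕ => (∑ x ∈ halfOpenBox 2 (2 * k), ∑ y ∈ halfOpenBox 2 (2 * k),
        torusPullback (pairFieldCorr g ψ) (2 * k) x y) / ((#(halfOpenBox 2 (2 * k)) : ℝ)) ^ 2) atTop ≤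
      0 := by
  have h := liminf_pairFieldLRO_le_sq_of_groundState_allMu_onePoint_bound g t t' hU hn0 hn2 (M := 0)
    (fun ω hTI _ hall => ?_) ψ hψ hψ1
  · simpa using h
  · have h₁ := (hall (chemPotMinusTT' t t' U n) ⟨le_rfl, hgap.le⟩).2
    have h₂ := (hall (chemPotPlusTT' t t' U n) ⟨hgap.le, le_rfl⟩).2
    rw [hTI.expect_localPairAt_eq_zero_of_isGroundState_hubbardTTPrimeMu_two t t' U hgap h₁ h₂
      (insert (0 : Site 2) unitSteps) g 0, Complex.zero_re]

/-- **Contrapositive DICTIONARY: a density carrying pair LRO has no charge gap.** If some family of unit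
`(rectN n L, S^z = 0)`-sector ground states of `hubbardTorusTT' L t t' U` has `liminf_k u_k > 0` (pair long-range
order for the form factor `g`), then `μ₋(n) = μ₊(n)`: the energy density is differentiable at `n`
(«ODLRO ⇒ no cusp», the lattice-fermion form of LSSY §11.3). [cite: LSSY2005, §11.3 eq. (11.29)–(11.30)]
[cite: KomaTasaki1994, Theorem 5] -/
theorem chemPotMinusTT'_eq_chemPotPlusTT'_of_pairLRO (t t' : ℝ) {U n : ℝ} (hU : 0 ≤ U) (hn0 : 0 < n)
    (hn2 : n < 2) (ψ : ∀ L, Fock (Orb (FermionTorus 2 L)))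
    (hψ : ∀ L, IsGroundStateInSector (hubbardTorusTT' L t t' U) (rectN n L) 0 (ψ L))
    (hψ1 : ∀ L, star (ψ L) ⬝ᵥ ψ L = 1)
    (hlro : 0 < liminf (fun k : ℕ => (∑ x ∈ halfOpenBox 2 (2 * k), ∑ y ∈ halfOpenBox 2 (2 * k),
        torusPullback (pairFieldCorr g ψ) (2 * k) x y) / ((#(halfOpenBox 2 (2 * k)) : ℝ)) ^ 2) atTop) :
    chemPotMinusTT' t t' U n = chemPotPlusTT' t t' U n := by
  refine le_antisymm (chemPotMinusTT'_le_chemPotPlusTT' t t' hU hn0 hn2) ?_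
  by_contra hlt
  rw [not_le] at hlt
  exact absurd (liminf_pairFieldLRO_le_zero_of_chemPot_lt g t t' hU hn0 hn2 hlt ψ hψ hψ1) (not_le.2 hlro)

/-- The same with the charge gap: pair LRO at density `n` forces `Δ_c(n) = μ₊(n) − μ₋(n) = 0`.
[cite: LiebWuPhysicaA2003, §7] [cite: LSSY2005, §11.3 eq. (11.29)–(11.30)] -/
theorem chargeGapTT'_eq_zero_of_pairLRO (t t' : ℝ) {U n : ℝ} (hU : 0 ≤ U) (hn0 : 0 < n) (hn2 : n < 2)
    (ψ : ∀ L, Fock (Orb (FermionTorus 2 L)))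
    (hψ : ∀ L, IsGroundStateInSector (hubbardTorusTT' L t t' U) (rectN n L) 0 (ψ L))
    (hψ1 : ∀ L, star (ψ L) ⬝ᵥ ψ L = 1)
    (hlro : 0 < liminf (fun k : ℕ => (∑ x ∈ halfOpenBox 2 (2 * k), ∑ y ∈ halfOpenBox 2 (2 * k),
        torusPullback (pairFieldCorr g ψ) (2 * k) x y) / ((#(halfOpenBox 2 (2 * k)) : ℝ)) ^ 2) atTop) :
    chargeGapTT' t t' U n = 0 := by
  rw [chargeGapTT'_def, ← chemPotMinusTT'_eq_chemPotPlusTT'_of_pairLRO g t t' hU hn0 hn2 ψ hψ hψ1 hlro, sub_self]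

end Family

/-! ### Registry form -/

/-- **REGISTRY CONSUMER: a certified charge gap is a certified ZERO pair-LRO ceiling.** At an anchor
`(U, n, t′)`, `t = 1`, `U ≥ 0`, `0 < n < 2`: `0 < chargeGapTT' 1 tp U n` gives `ObsPairLROCeilingAt tp U n c'` for
every rational `c' ≥ 0`. [cite: KomaTasaki1994, Theorem 5] [cite: LiebWuPhysicaA2003, §7] -/
theorem ObsPairLROCeilingAt_of_chargeGap_pos {tp U n : ℝ} (hU : 0 ≤ U) (hn0 : 0 < n) (hn2 : n < 2)
    (hgap : 0 < chargeGapTT' 1 tp U n) {c' : ℚ} (hc' : 0 ≤ c') : ObsPairLROCeilingAt tp U n c' := by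
  intro ψ hψ hψ1
  have hlt : chemPotMinusTT' 1 tp U n < chemPotPlusTT' 1 tp U n := by
    rw [chargeGapTT'_def] at hgap; linarith
  refine (liminf_pairFieldLRO_le_zero_of_chemPot_lt dWaveFormFactor 1 tp hU hn0 hn2 hlt ψ hψ hψ1).trans ?_
  exact_mod_cast hc'

/-- **The zero ceiling**: `0 < chargeGapTT' 1 tp U n ⇒ ObsPairLROCeilingAt tp U n 0`. [cite: KomaTasaki1994, Theorem 5]
[cite: LiebWuPhysicaA2003, §7] -/
theorem ObsPairLROCeilingAt_zero_of_chargeGap_pos {tp U n : ℝ} (hU : 0 ≤ U) (hn0 : 0 < n) (hn2 : n < 2)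
    (hgap : 0 < chargeGapTT' 1 tp U n) : ObsPairLROCeilingAt tp U n 0 :=
  ObsPairLROCeilingAt_of_chargeGap_pos hU hn0 hn2 hgap le_rfl

/-- **At the cuprate anchor `(8, 7/8, t′)`**: a certified charge gap `0 < Δ_c(7/8)` would be a certified
`M3ObsPairLROCeilingAt tp 0` — the summit-format `d`-wave pair-LRO ceiling at threshold ZERO (today no kink of
`e(n)` is certified at any density; this is the logical route «incompressible ⇒ ABSENT»). [cite: KomaTasaki1994, Theorem 5]
[cite: LiebWuPhysicaA2003, §7] -/
theorem M3ObsPairLROCeilingAt_of_chargeGap_pos (tp : ℝ) (hgap : 0 < chargeGapTT' 1 tp 8 (7 / 8)) {c : ℚ}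
    (hc : 0 ≤ c) : M3ObsPairLROCeilingAt tp c := by
  intro ψ hψ hψ1
  exact ObsPairLROCeilingAt_of_chargeGap_pos (by norm_num) (by norm_num) (by norm_num) hgap hc ψ hψ hψ1

end Summit.Ventures.CertifiedManyBodySolver.Observables

end
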